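import Mathlib.NumberTheory.LSeries.RiemannZeta
import HarnessLib

/-!
# RiemannHypothesis — problem statement (D-0013; operator-created)

The problem IS Mathlib's `RiemannHypothesis`; this file only gives it the canonical summit name
`Summit.RiemannHypothesis` (docs/gate.md: Mathlib owns the root name, so the summit def lives in
`namespace Summit`).

Source (Clay official text): E. Bombieri, *Problems of the Millennium: the Riemann Hypothesis* (2000), §I:
"The function ζ(s) has zeros at the negative even integers −2, −4, … and one refers to them as the
trivial zeros. […] Riemann hypothesis. The nontrivial zeros of ζ(s) have real part equal to 1/2."

Reading of Mathlib's clauses against the source (audit 2026-08-13):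
* `riemannZeta` is Mathlib's total function `ℂ → ℂ`; it agrees with the analytic continuation of
  `∑ n⁻ˢ` on `{s ≠ 1}` and takes the junk value `(γ - log 4π)/2` at the pole `s = 1`
  (`riemannZeta_one`). The clause `s ≠ 1` removes the pole from the quantifier; it is in fact
  redundant (`riemannZeta_one_ne_zero`) but harmless and matches "zeros of the meromorphic ζ".
* `¬∃ n : ℕ, s = -2 * (n + 1)` is exactly "s is not one of −2, −4, −6, …" (the trivial zeros).
* `s.re = 1 / 2` is real division (`(1:ℝ)/2 = 2⁻¹`).
-/

namespace Summit

/-- **rh.S01** The Riemann Hypothesis: every non-trivial zero of `riemannZeta` has real part `1/2`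
(Mathlib's `RiemannHypothesis`, verbatim: `∀ (s : ℂ), riemannZeta s = 0 → (¬∃ n : ℕ, s = -2 * (n + 1)) → s ≠ 1 → s.re = 1 / 2`).
Bombieri (Clay 2000, §I): "The nontrivial zeros of ζ(s) have real part equal to 1/2", the trivial zeros
being the negative even integers.
[problem: rh] [cite: Bombieri2000, §I] -/
def RiemannHypothesis : Prop := _root_.RiemannHypothesis

/-- Unfolding lemma: the summit is definitionally Mathlib's statement. [folklore] -/
theorem RiemannHypothesis_iff : Summit.RiemannHypothesis ↔ _root_.RiemannHypothesis := Iff.rfl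

end Summit
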